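import Literature.NumberTheory.LFunctions.CertifiedDirichletLTuringAbs
import Literature.NumberTheory.LFunctions.TuringMethodTrudgianNumericsCheck
import HarnessLib

/-!
# Turing's method for a REAL (quadratic) primitive Dirichlet character: single-character bounds

For a quadratic character `χ̄ = χ` (`MulChar.IsQuadratic.inv`), the pair form
`∫S(t,χ)dt + ∫S(t,χ̄)dt` of the preceding files is `2∫S(t,χ)dt`, so Turing's bound holds for the single
character with HALF the pair constants:

* `TuringDirichlet.abs_integral_lfunctionArgS_le_of_isQuadratic` — Trudgian 2011 Theorem 3.8 shape,
  unconditional, parametric in `(c, d, t₀)`: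
  `π |∫_{t₁}^{t₂} S(t,χ)dt| ≤ (a₁ + a₂) + (b₁ + b₂) log(qt₂/2π)`.
* `TuringDirichlet.abs_integral_lfunctionArgS_le_numeric_of_isQuadratic` — for `50 < t₁ ≤ t₂`,
  `|∫_{t₁}^{t₂} S(t,χ) dt| ≤ 2.26 + 0.0642 log(qt₂/2π)` (the tree's certified `ζ` numerics via
  `native_decide`, as in `CertifiedDirichletLTuringNumericsHolds.lean`; printed comparators for arbitrary
  primitive `χ`: Rumely 1993 Thm 2 `1.8397 + 0.1242 log(qt₂/2π)`, Trudgian 2011 Thm 3.3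
  `1.975 + 0.084 log(qt₂/2π)`).
* `LFunctionRHUpTo.of_turing_isQuadratic` — the GRH-verification step for a real primitive `χ` up to
  height `T > 50` from its own certified zeros only (`Z' = Z`) and one decimal inequality.

## References
* T. S. Trudgian, Improvements to Turing's method, Math. Comp. 80 (2011), §3.4 Theorem 3.8, §3.5.
  [Trudgian2011]
* R. Rumely, Math. Comp. 61 (1993), Theorem 2 p. 429. [Rumely1993ERH]
* D. J. Platt, Math. Comp. 85 (2016), Theorem 3.2. [Platt2016GRH]
-/

noncomputable section

open Complex Set MeasureTheory intervalIntegral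
open scoped Real

namespace Literature.NumberTheory.LFunctions

open DirichletCharacter ExplicitPsiChar Trudgian2011Dirichlet TrudgianNumerics

namespace TuringDirichlet

variable {q : ℕ} [NeZero q] {χ : DirichletCharacter ℂ q}

/-- **Trudgian 2011, Theorem 3.8 for a real primitive character — unconditional**: for a quadratic
primitive `χ` modulo `q > 1`, `1 < c ≤ 5/4`, `½ < d ≤ 1`, `1 ≤ t₀ < t₁ ≤ t₂`, `t₁`, `t₂` ordinates of
no zero of `L(s,χ)` with `0 < Re s < 1`,
`π |∫_{t₁}^{t₂} S(t,χ)dt| ≤ (a₁ + a₂) + (b₁ + b₂) log(qt₂/2π)` with the constants of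
`pi_mul_integral_lfunctionArgS_pair_le` (half the pair bound, since `χ̄ = χ`).
[cite: Trudgian2011, §3.4 Theorem 3.8] -/
theorem abs_integral_lfunctionArgS_le_of_isQuadratic (hq : 1 < q) (hχ : χ.IsPrimitive)
    (hχ2 : MulChar.IsQuadratic χ) {c d t₀ t₁ t₂ : ℝ} (hc1 : 1 < c) (hc : c ≤ 5 / 4) (hd : 1 / 2 < d)
    (hd1 : d ≤ 1) (ht₀ : 1 ≤ t₀) (h01 : t₀ < t₁) (h12 : t₁ ≤ t₂)
    (hz₁ : ∀ ρ ∈ charNontrivialZeros χ, ρ.im ≠ t₁) (hz₂ : ∀ ρ ∈ charNontrivialZeros χ, ρ.im ≠ t₂) :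
    π * |∫ t in t₁..t₂, lfunctionArgS χ t| ≤
      ((729 / (2048 * t₀ ^ 2) + (c - 1 / 2) * logZeta c + ∫ σ in Ioi c, logZeta σ) +
          (d ^ 2 * Real.log 4 *
              ((2 * (deriv riemannZeta (2 * (1 / 2 + d) : ℝ) / riemannZeta (2 * (1 / 2 + d) : ℝ)).re -
                  (deriv riemannZeta (1 / 2 + d : ℝ) / riemannZeta (1 / 2 + d : ℝ)).re) +
                turingEps' t₀) +
            d ^ 2 * turingEps t₀ - turingI d)) +
        ((c - 1 / 2) ^ 2 / 4 + d ^ 2 / 2 * (Real.log 4 - 1)) * Real.log (q * t₂ / (2 * π)) := by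
  have hinv : χ⁻¹ = χ := hχ2.inv
  have h := abs_integral_lfunctionArgS_pair_le hq hχ hc1 hc hd hd1 ht₀ h01 h12 hz₁
    (by rw [hinv]; exact hz₁) hz₂ (by rw [hinv]; exact hz₂)
  rw [hinv, ← two_mul, abs_mul, abs_two] at h
  linarith

/-- **Numerical Turing bound for a real primitive character:** for a quadratic primitive `χ` modulo
`q > 1` and `50 < t₁ ≤ t₂`, `t₁`, `t₂` ordinates of no zero of `L(s,χ)` with `0 < Re s < 1`,
`|∫_{t₁}^{t₂} S(t,χ) dt| ≤ 2.26 + 0.0642·log(qt₂/2π)` (the certified `ζ` numerics of the tree, via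
`native_decide`). [cite: Trudgian2011, §3.5 and Theorem 3.3] -/
theorem abs_integral_lfunctionArgS_le_numeric_of_isQuadratic (hq : 1 < q) (hχ : χ.IsPrimitive)
    (hχ2 : MulChar.IsQuadratic χ) {t₁ t₂ : ℝ} (h01 : 50 < t₁) (h12 : t₁ ≤ t₂)
    (hz₁ : ∀ ρ ∈ charNontrivialZeros χ, ρ.im ≠ t₁) (hz₂ : ∀ ρ ∈ charNontrivialZeros χ, ρ.im ≠ t₂) :
    |∫ t in t₁..t₂, lfunctionArgS χ t| ≤ 2.26 + 0.0642 * Real.log (q * t₂ / (2 * π)) := by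
  have hinv : χ⁻¹ = χ := hχ2.inv
  have h := abs_integral_lfunctionArgS_pair_le_numeric trudgianCheck_eq_true hq hχ h01 h12 hz₁
    (by rw [hinv]; exact hz₁) hz₂ (by rw [hinv]; exact hz₂)
  rw [hinv, ← two_mul, abs_mul, abs_two] at h
  linarith

end TuringDirichlet

open TuringDirichlet in
/-- **The GRH-verification step for a REAL primitive character up to height `T > 50`** (Platt 2016
Thm. 3.2 with the numerical Turing bound; `χ̄ = χ`, so only the zeros of `L(s,χ)` itself enter): for a
quadratic primitive `χ` of conductor `q > 1`, `h > 0`, `±T`, `±(T+h)` ordinates of no non-trivial zero,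
found zeros `W` (on the critical line, `|γ| ≤ T`, `#W = n`) and `Z` (on the line, ordinates in
`(T, T+h]`) and the single decimal inequality
`2(2.26 + 0.0642 log(q(T+h)/2π)) + (2/π)∫_T^{T+h} θ(t,χ)dt − 2 Σ_Z(T+h−γ) < h(n+1)`
certify `LFunctionRHUpTo χ T ∧ N_χ(T) = N_{χ,0}(T) = n`. [cite: Platt2016GRH, Theorem 3.2]
[cite: Trudgian2011, Theorem 3.3] -/
theorem LFunctionRHUpTo.of_turing_isQuadratic {q : ℕ} [NeZero q] {χ : DirichletCharacter ℂ q}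
    (hχ : χ.IsPrimitive) (hχ2 : MulChar.IsQuadratic χ) (hq : 1 < q) {T h : ℝ} {n : ℕ} (hT : 50 < T)
    (hh : 0 < h)
    (hz : ∀ ρ ∈ charNontrivialZeros χ, ρ.im ≠ T ∧ ρ.im ≠ -T)
    (hzh : ∀ ρ ∈ charNontrivialZeros χ, ρ.im ≠ T + h ∧ ρ.im ≠ -(T + h))
    (W : Finset ℝ) (hW : ∀ γ ∈ W, χ.LFunction (1 / 2 + γ * I) = 0 ∧ |γ| ≤ T) (hWn : W.card = n)
    (Z : Finset ℝ) (hZ : ∀ γ ∈ Z, χ.LFunction (1 / 2 + γ * I) = 0 ∧ T < γ ∧ γ ≤ T + h)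
    (hnum : 2 * (2.26 + 0.0642 * Real.log (q * (T + h) / (2 * π))) +
        2 / π * (∫ t in T..T + h, lfunctionTheta χ t) - 2 * ∑ γ ∈ Z, (T + h - γ) < h * (n + 1)) :
    LFunctionRHUpTo χ T ∧ lfunctionZeroCount χ T = n ∧ lfunctionCriticalZeroCount χ T = n := by
  have hinv : χ⁻¹ = χ := hχ2.inv
  refine LFunctionRHUpTo.of_turing_numeric TrudgianNumerics.trudgianCheck_eq_true hχ hq hT hh hz hzh
    W hW hWn Z hZ Z ?_ ?_
  · rw [hinv]; exact hZ
  · linarith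

end Literature.NumberTheory.LFunctions

end
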